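import Mathlib
import HarnessLib
import Summits.ResolutionOfSingularities.ResolutionOfSingularities.Theorems.WildQuotientsWildQuotientResolutionJordanFourTwistedChartDefs
import Summits.ResolutionOfSingularities.ResolutionOfSingularities.Theorems.WildQuotientsWildQuotientResolutionJordanFourConeVertexIdeals
import Summits.ResolutionOfSingularities.ResolutionOfSingularities.Theorems.WildQuotientsWildQuotientResolutionJordanFourConeVertexContraction

/-!
# V4U brick `H₁`, algebra (1): the vertex locus on the twisted root chart is `s = A = ξ = 0`
(crux stmt-ResolutionOfSingularities-15640 `WildQuotients.WildQuotientResolution`, line `Sketch`;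
chain w45c programme V4U, `L/w45c/CHAIN.md` v7.6 §4, brick `H₁` = lead-1 p505172
`BlowupExit.exists_isBlowup_regular_of_vertexPresentation` hypothesis `H` at the `μ₂` piece
`O₁ = W_T`, ORDER res-L1-w45c-plan-1 RULING v7.5a/CORRECTION 2026-08-27T06:30:44Z → res-type-036;
[OURS · L1 W4.5c] — NOT a statement of any manuscript; replaces the role of no printed item.)

The radical identity of the `μ₂` cone brick on the ROOT-CHART side. Under res-L1-w45c-stub-1's
twisted chart `ψ_T = JordanFour.twistedChart` (slots `s = X b`, `A = X a`, `ξ = X c`, `η = X d`;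
`ψ_T(x_a) = s³A`, `ψ_T(x_b) = s²(1 + Aξ)`, `ψ_T(x_c) = s·P`) and its `q`-vector
`JordanFour.twistedCofactor` (`ψ_T(g_j) = s⁶ q_j`, so the chart ratios `g_j t / T′t` become `q_j / Q`),
the equations of the vertex curve `C₁ ∩ W_T` — `π^*x_a, π^*x_b, π^*x_c` and the ratios `g_j/T′`
for `j ≠ 4` — generate on the root chart the ideal
`J_T = (ψ_T x_a, ψ_T x_b, ψ_T x_c, q_j (j ≠ 4))`, and

* `span_twistedVertex_le` — `J_T ⊆ (X a, X b, X c)`;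
* `X_mem_radical_span_twistedVertex_a/_b/_c` — `X a, X b, X c ∈ √J_T` (`A² = q₀`, `P⁶ = q₇`,
  `s²(1 + Aξ) = ψ_T x_b`);
* `isPrime_span_X_abc` — `(X a, X b, X c)` is prime (res-L1-w45c-stub-4's
  `ConeVertex.isPrime_span_X_image_compl_range`);
* **`radical_span_twistedVertex_eq`** — `√J_T = (X a, X b, X c)`: the vertex locus of the twisted
  root chart is `{s = A = ξ = 0} × (η, passengers)`, every characteristic, any field with `2 ∈ kˣ`
  irrelevant (the statement is characteristic-free).
-/

-- single-problem summit: the doubled namespace component `ResolutionOfSingularities` is forced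
set_option linter.dupNamespace false

noncomputable section

open MvPolynomial

namespace Summit.ResolutionOfSingularities.ResolutionOfSingularities.Theorems.WildQuotientResolution.JordanFour

variable (k : Type) [Field k] (n : ℕ) (a b c d : Fin n)

/-- `(X a, X b, X c) ⊆ k[x₁,…,xₙ]` is a prime ideal (the quotient is the polynomial ring on the other
variables). [folklore] -/
theorem isPrime_span_X_abc : (Ideal.span {(X a : MvPolynomial (Fin n) k), X b, X c}).IsPrime := by
  have hrange : (Set.range (fun i : {i : Fin n // i ≠ a ∧ i ≠ b ∧ i ≠ c} => (i.1 : Fin n)))ᶜ =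
      ({a, b, c} : Set (Fin n)) := by
    ext i
    simp only [Set.mem_compl_iff, Set.mem_range, not_exists, Set.mem_insert_iff,
      Set.mem_singleton_iff]
    constructor
    · intro h
      by_contra h'
      push Not at h'
      exact h ⟨i, h'⟩ rfl
    · rintro (rfl | rfl | rfl) ⟨j, hj⟩ hji <;> simp only at hji <;> subst hji
      exacts [hj.1 rfl, hj.2.1 rfl, hj.2.2 rfl]
  have h := ConeVertex.isPrime_span_X_image_compl_range (R := k)
    (f := fun i : {i : Fin n // i ≠ a ∧ i ≠ b ∧ i ≠ c} => (i.1 : Fin n)) (fun i j h => Subtype.ext h)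
  rwa [hrange, ← Third112.X_triple_eq_image] at h

/-- `P = ξ + s + (A/2)(ξ² − sξ − η) ∈ (X a, X b, X c)`. [folklore] -/
theorem twistedP_mem_span_X_abc :
    twistedP k n a b c d ∈ Ideal.span {(X a : MvPolynomial (Fin n) k), X b, X c} := by
  have ha : (X a : MvPolynomial (Fin n) k) ∈ Ideal.span {(X a : MvPolynomial (Fin n) k), X b, X c} :=
    Ideal.subset_span (by simp)
  have hb : (X b : MvPolynomial (Fin n) k) ∈ Ideal.span {(X a : MvPolynomial (Fin n) k), X b, X c} :=
    Ideal.subset_span (by simp)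
  have hc : (X c : MvPolynomial (Fin n) k) ∈ Ideal.span {(X a : MvPolynomial (Fin n) k), X b, X c} :=
    Ideal.subset_span (by simp)
  rw [twistedP, show C (2⁻¹ : k) * X a * (X c ^ 2 - X b * X c - X d) =
    (C (2⁻¹ : k) * (X c ^ 2 - X b * X c - X d)) * X a by ring]
  exact Ideal.add_mem _ (Ideal.add_mem _ hc hb) (Ideal.mul_mem_left _ _ ha)

/-- **`J_T ⊆ (X a, X b, X c)`**: every equation of the vertex curve vanishes on `s = A = ξ = 0`.
[OURS · L1 W4.5c] [folklore] -/
theorem span_twistedVertex_le (hab : a ≠ b) (hac : a ≠ c) (hbc : b ≠ c) :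
    Ideal.span (twistedChart k n a b c d '' {X a, X b, X c} ∪
        Set.range (fun j : {j : Fin 8 // j ≠ 4} => twistedCofactor k n a b c d j.1)) ≤
      Ideal.span {(X a : MvPolynomial (Fin n) k), X b, X c} := by
  set M : Ideal (MvPolynomial (Fin n) k) := Ideal.span {(X a : MvPolynomial (Fin n) k), X b, X c}
    with hM
  have ha : (X a : MvPolynomial (Fin n) k) ∈ M := Ideal.subset_span (by simp)
  have hb : (X b : MvPolynomial (Fin n) k) ∈ M := Ideal.subset_span (by simp)
  have hc : (X c : MvPolynomial (Fin n) k) ∈ M := Ideal.subset_span (by simp)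
  have hP : twistedP k n a b c d ∈ M := twistedP_mem_span_X_abc k n a b c d
  rw [Ideal.span_le]
  rintro f (⟨x, hx, rfl⟩ | ⟨⟨j, hj⟩, rfl⟩)
  · simp only [Set.mem_insert_iff, Set.mem_singleton_iff] at hx
    rcases hx with rfl | rfl | rfl
    · rw [SetLike.mem_coe, twistedChart_X_a]
      exact Ideal.mul_mem_left _ _ ha
    · rw [SetLike.mem_coe, twistedChart_X_b k n a b c d hab]
      exact Ideal.mul_mem_right _ _ (Ideal.pow_mem_of_mem _ hb 2 two_pos)
    · rw [SetLike.mem_coe, twistedChart_X_c k n a b c d hac hbc]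
      exact Ideal.mul_mem_right _ _ hb
  · rw [SetLike.mem_coe]
    fin_cases j
    · change X a ^ 2 ∈ M
      exact Ideal.pow_mem_of_mem _ ha 2 two_pos
    · change X b * X a * (1 + X a * X c) ^ 2 ∈ M
      exact Ideal.mul_mem_right _ _ (Ideal.mul_mem_right _ _ hb)
    · change X a * (1 + X a * X c) * twistedP k n a b c d ∈ M
      exact Ideal.mul_mem_left _ _ hP
    · change X a * twistedP k n a b c d ^ 3 ∈ M
      exact Ideal.mul_mem_left _ _ (Ideal.pow_mem_of_mem _ hP 3 (by norm_num))
    · exact absurd rfl hj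
    · change (1 + X a * X c) ^ 2 * twistedP k n a b c d ^ 2 ∈ M
      exact Ideal.mul_mem_left _ _ (Ideal.pow_mem_of_mem _ hP 2 two_pos)
    · change (1 + X a * X c) * twistedP k n a b c d ^ 4 ∈ M
      exact Ideal.mul_mem_left _ _ (Ideal.pow_mem_of_mem _ hP 4 (by norm_num))
    · change twistedP k n a b c d ^ 6 ∈ M
      exact Ideal.pow_mem_of_mem _ hP 6 (by norm_num)

/-- `X a ∈ √J_T` (`A² = q₀`). [OURS · L1 W4.5c] [folklore] -/
theorem X_a_mem_radical_span_twistedVertex :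
    (X a : MvPolynomial (Fin n) k) ∈ (Ideal.span (twistedChart k n a b c d '' {X a, X b, X c} ∪
        Set.range (fun j : {j : Fin 8 // j ≠ 4} => twistedCofactor k n a b c d j.1))).radical := by
  refine ⟨2, Ideal.subset_span (Or.inr ⟨⟨0, by decide⟩, ?_⟩)⟩
  rfl

/-- `P ∈ √J_T` (`P⁶ = q₇`). [OURS · L1 W4.5c] [folklore] -/
theorem twistedP_mem_radical_span_twistedVertex :
    twistedP k n a b c d ∈ (Ideal.span (twistedChart k n a b c d '' {X a, X b, X c} ∪
        Set.range (fun j : {j : Fin 8 // j ≠ 4} => twistedCofactor k n a b c d j.1))).radical := by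
  refine ⟨6, Ideal.subset_span (Or.inr ⟨⟨7, by decide⟩, ?_⟩)⟩
  rfl

/-- `X b ∈ √J_T` (`s²(1 + Aξ) = ψ_T x_b ∈ J_T` and `A ∈ √J_T`). [OURS · L1 W4.5c] [folklore] -/
theorem X_b_mem_radical_span_twistedVertex (hab : a ≠ b) :
    (X b : MvPolynomial (Fin n) k) ∈ (Ideal.span (twistedChart k n a b c d '' {X a, X b, X c} ∪
        Set.range (fun j : {j : Fin 8 // j ≠ 4} => twistedCofactor k n a b c d j.1))).radical := by
  set J := Ideal.span (twistedChart k n a b c d '' {X a, X b, X c} ∪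
        Set.range (fun j : {j : Fin 8 // j ≠ 4} => twistedCofactor k n a b c d j.1)) with hJ
  have hxb : X b ^ 2 * (1 + X a * X c) ∈ J := by
    rw [← twistedChart_X_b k n a b c d hab]
    exact Ideal.subset_span (Or.inl ⟨X b, by simp, rfl⟩)
  have hxa : (X a : MvPolynomial (Fin n) k) ∈ J.radical := X_a_mem_radical_span_twistedVertex k n a b c d
  have h2 : (X b : MvPolynomial (Fin n) k) ^ 2 ∈ J.radical := by
    have e : (X b : MvPolynomial (Fin n) k) ^ 2 =
        X b ^ 2 * (1 + X a * X c) - (X b ^ 2 * X c) * X a := by ring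
    rw [e]
    exact Ideal.sub_mem _ (Ideal.le_radical hxb) (Ideal.mul_mem_left _ _ hxa)
  exact Ideal.mem_radical_of_pow_mem h2

/-- `X c ∈ √J_T` (`ξ = P − s − (A/2)(ξ² − sξ − η)` with `P, s, A ∈ √J_T`). [OURS · L1 W4.5c] [folklore] -/
theorem X_c_mem_radical_span_twistedVertex (hab : a ≠ b) :
    (X c : MvPolynomial (Fin n) k) ∈ (Ideal.span (twistedChart k n a b c d '' {X a, X b, X c} ∪
        Set.range (fun j : {j : Fin 8 // j ≠ 4} => twistedCofactor k n a b c d j.1))).radical := by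
  set J := Ideal.span (twistedChart k n a b c d '' {X a, X b, X c} ∪
        Set.range (fun j : {j : Fin 8 // j ≠ 4} => twistedCofactor k n a b c d j.1)) with hJ
  have hxa : (X a : MvPolynomial (Fin n) k) ∈ J.radical := X_a_mem_radical_span_twistedVertex k n a b c d
  have hxb : (X b : MvPolynomial (Fin n) k) ∈ J.radical :=
    X_b_mem_radical_span_twistedVertex k n a b c d hab
  have hP : twistedP k n a b c d ∈ J.radical := twistedP_mem_radical_span_twistedVertex k n a b c d
  have e : (X c : MvPolynomial (Fin n) k) =
      twistedP k n a b c d - X b - (C (2⁻¹ : k) * (X c ^ 2 - X b * X c - X d)) * X a := by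
    rw [twistedP]; ring
  rw [e]
  exact Ideal.sub_mem _ (Ideal.sub_mem _ hP hxb) (Ideal.mul_mem_left _ _ hxa)

/-- **The vertex locus of the twisted root chart: `√J_T = (X a, X b, X c)`** — the radical of the
ideal generated by `ψ_T x_a, ψ_T x_b, ψ_T x_c` and the cofactors `q_j`, `j ≠ 4`, is the ideal of
`{s = A = ξ = 0}` (the `μ₂`-vertex line upstairs, over which sits the vertex of the `½(1,1,1)` cone
downstairs). [OURS · L1 W4.5c] [folklore] -/
theorem radical_span_twistedVertex_eq (hab : a ≠ b) (hac : a ≠ c) (hbc : b ≠ c) :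
    (Ideal.span (twistedChart k n a b c d '' {X a, X b, X c} ∪
        Set.range (fun j : {j : Fin 8 // j ≠ 4} => twistedCofactor k n a b c d j.1))).radical =
      Ideal.span {(X a : MvPolynomial (Fin n) k), X b, X c} := by
  haveI := isPrime_span_X_abc k n a b c
  refine le_antisymm ?_ ?_
  · exact ((isPrime_span_X_abc k n a b c).radical_le_iff).mpr
      (span_twistedVertex_le k n a b c d hab hac hbc)
  · rw [Ideal.span_le]
    rintro x hx
    simp only [Set.mem_insert_iff, Set.mem_singleton_iff] at hx
    rcases hx with rfl | rfl | rfl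
    · exact X_a_mem_radical_span_twistedVertex k n a b c d
    · exact X_b_mem_radical_span_twistedVertex k n a b c d hab
    · exact X_c_mem_radical_span_twistedVertex k n a b c d hab

end Summit.ResolutionOfSingularities.ResolutionOfSingularities.Theorems.WildQuotientResolution.JordanFour

end
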